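import Mathlib
import HarnessLib
import Literature.AlgebraicGeometry.Ramification.InertiaNormalSylow
import Summits.ResolutionOfSingularities.ResolutionOfSingularities.Theorems.WildQuotientsWildQuotientResolutionTameCoresPhaseZero

/-!
# Phase 0 in EVERY dimension for extensions of a `p`-group by a CYCLIC group of order prime to `p`
# (crux `WildQuotients.WildQuotientResolution`, stub `stub_phaseZeroHighDim`)

Crux stmt-ResolutionOfSingularities-15640 (`WildQuotientResolution`), registered stub `stub_phaseZeroHighDim`.
The k-core theorem ✓`phaseZero_of_tameCores` (p822635) applied to the cleanest natural class:

**Theorem** (`phaseZero_of_quotient_isPGroup_cyclic`). Let `N ⊴ G` be CYCLIC of order prime to `p` with `G ⧸ N`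
a `p`-group (equivalently: `G = N ⋊ P` with `N` a cyclic normal `p′`-Hall subgroup — all `C_m ⋊ P`, in particular
every dihedral group `D_m`, `m` odd, in characteristic `2`, every `C_m ⋊ C_{p^a}`). Then for every crux datum —
`X′` integral regular of ANY dimension, finite over the separated finite-type `X₁/k`, `char k = p`, faithful action of
`G` over `q` — the conclusion of `stub_phaseZeroHighDim` holds: an equivariant proper birational regular model
with a `G`-stable affine cover all of whose inertia groups have a normal Sylow `p`-subgroup. The cores are the
subgroups of prime order of `N` (one tame move each).

Group theory (`mem_zpowers_of_pow_orderOf_eq_one`): in a cyclic group an element killed by the order of `y` is a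
power of `y` (counting: `#{a | a^m = 1} ≤ m`, Mathlib `IsCyclic.card_pow_eq_one_le`); hence the subgroups of `N`
are normal in `G` and the subgroup of prime order `ℓ ∣ ord h` lies in `⟨h⟩`.

[OURS · crux stmt-ResolutionOfSingularities-15640 · helper toward `stub_phaseZeroHighDim` (an all-dimensional SLICE
of the stub; NOT a proof of the stub); counted 0; AI-level work, weaker than expert review.] [folklore]
-/

-- single-problem summit: the doubled namespace component `ResolutionOfSingularities` is forced
set_option linter.dupNamespace false

noncomputable section

open CategoryTheory AlgebraicGeometry TopologicalSpace IsLocalRing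
open Literature.AlgebraicGeometry.Resolution Literature.AlgebraicGeometry.Ramification

namespace Summit.ResolutionOfSingularities.ResolutionOfSingularities.Theorems.WildQuotientResolution.StandardForm

section Group

variable {G : Type} [Group G]

/-- **In a cyclic group an element killed by `ord y` is a power of `y`** (for `x, y` in a cyclic subgroup `N`:
`x ^ ord y = 1 ⇒ x ∈ ⟨y⟩`), by counting: `⟨y⟩` has `ord y` elements killed by `ord y`, and a cyclic group has at
most that many (Mathlib `IsCyclic.card_pow_eq_one_le`). [folklore] -/
theorem mem_zpowers_of_pow_orderOf_eq_one [Finite G] {N : Subgroup G} [IsCyclic N] {x y : G}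
    (hx : x ∈ N) (hy : y ∈ N) (h : x ^ orderOf y = 1) : x ∈ Subgroup.zpowers y := by
  classical
  haveI : Fintype N := Fintype.ofFinite N
  set x' : N := ⟨x, hx⟩ with hx'
  set y' : N := ⟨y, hy⟩ with hy'
  suffices hmem : x' ∈ Subgroup.zpowers y' by
    obtain ⟨k, hk⟩ := Subgroup.mem_zpowers_iff.mp hmem
    exact Subgroup.mem_zpowers_iff.mpr ⟨k, by simpa [hx', hy'] using congrArg Subtype.val hk⟩
  set m := orderOf y' with hmdef
  have hm0 : 0 < m := orderOf_pos y'
  have hmy : orderOf y = m := by rw [hmdef, ← Subgroup.orderOf_coe y']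
  let S : Finset N := Finset.univ.filter fun a : N => a ^ m = 1
  let T : Finset N := (Subgroup.zpowers y' : Set N).toFinset
  have hTS : T ⊆ S := by
    intro a ha
    rw [Set.mem_toFinset, SetLike.mem_coe, Subgroup.mem_zpowers_iff] at ha
    obtain ⟨k, rfl⟩ := ha
    simp only [S, Finset.mem_filter, Finset.mem_univ, true_and]
    rw [← zpow_natCast, ← zpow_mul, mul_comm, zpow_mul, zpow_natCast, pow_orderOf_eq_one, one_zpow]
  have hcardT : T.card = m := by
    simp only [T, Set.toFinset_card]
    exact Fintype.card_zpowers
  have hcardS : S.card ≤ m := IsCyclic.card_pow_eq_one_le hm0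
  have hEq : T = S := Finset.eq_of_subset_of_card_le hTS (hcardT ▸ hcardS)
  have hxS : x' ∈ S := by
    simp only [S, Finset.mem_filter, Finset.mem_univ, true_and]
    apply Subtype.ext
    rw [Subgroup.coe_pow, Subgroup.coe_one, ← hmy]
    exact h
  rw [← hEq] at hxS
  simpa [T, Set.mem_toFinset] using hxS

/-- A subgroup generated by an element of a normal cyclic subgroup is normal. [folklore] -/
theorem normal_zpowers_of_mem_cyclic [Finite G] {N : Subgroup G} [N.Normal] [IsCyclic N] {y : G}
    (hy : y ∈ N) : (Subgroup.zpowers y).Normal := by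
  refine ⟨fun x hx g => ?_⟩
  have hgy : g * y * g⁻¹ ∈ Subgroup.zpowers y := by
    refine mem_zpowers_of_pow_orderOf_eq_one (N := N) (Subgroup.Normal.conj_mem inferInstance y hy g) hy ?_
    rw [conj_pow, pow_orderOf_eq_one, mul_one, mul_inv_cancel]
  obtain ⟨k, rfl⟩ := Subgroup.mem_zpowers_iff.mp hx
  rw [← conj_zpow]
  exact Subgroup.zpow_mem _ hgy k

end Group

/-- **Phase 0 in every dimension for `p`-groups extended by a cyclic tame group** (crux
stmt-ResolutionOfSingularities-15640, an all-dimensional SLICE of `stub_phaseZeroHighDim`). Let `N ⊴ G` be cyclic of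
order prime to `p` with `G ⧸ N` a `p`-group. Then for the crux data (`k` of characteristic `p`, `X₁/k` separated of
finite type, `X′` integral regular of any dimension, `q : X′ → X₁` finite, `ρ` faithful over `q`) there is an
equivariant proper birational regular model with a `G`-stable affine cover all of whose inertia groups have a normal
Sylow `p`-subgroup. [folklore] -/
theorem phaseZero_of_quotient_isPGroup_cyclic (p : ℕ) (hp : p.Prime) (k : Type) [Field k] [CharP k p]
    (X' X₁ : Scheme.{0}) (f : X₁ ⟶ Spec (.of k)) (q : X' ⟶ X₁) (G : Type) [Group G] [Finite G]
    (ρ : G →* Aut X') (hfaith : Function.Injective ρ)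
    [IsSeparated f] [LocallyOfFiniteType f] [QuasiCompact f] [IsIntegral X']
    (hreg : Scheme.IsRegular X') [IsFinite q] (hρ : ∀ g : G, (ρ g).hom ≫ q = q)
    (N : Subgroup G) [N.Normal] [IsCyclic N] (hN : (Nat.card N).Coprime p) (hQ : IsPGroup p (G ⧸ N)) :
    ∃ (Xs : Scheme.{0}) (π : Xs ⟶ X') (ρs : G →* Aut Xs), IsProper π ∧ IsBirational π ∧
      IsIntegral Xs ∧ Scheme.IsRegular Xs ∧ (∀ g : G, (ρs g).hom ≫ π = π ≫ (ρ g).hom) ∧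
      (∀ x : Xs, HasNormalSylow p (inertiaSubgroup ρs x)) ∧
      ∀ x : Xs, ∃ U : Xs.Opens, IsAffineOpen U ∧ x ∈ U ∧ ∀ g : G, (ρs g).hom ⁻¹ᵁ U = U := by
  classical
  haveI : Fact p.Prime := ⟨hp⟩
  -- a generator of `N` and the order `n`
  obtain ⟨g₀, hg₀⟩ := (Subgroup.isCyclic_iff_exists_zpowers_eq_top N).mp inferInstance
  set n := Nat.card N with hndef
  have hn : orderOf g₀ = n := by rw [hndef, ← hg₀, Nat.card_zpowers]
  have hn0 : n ≠ 0 := by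
    rw [← hn]; exact (orderOf_pos g₀).ne'
  have hg₀N : g₀ ∈ N := hg₀ ▸ Subgroup.mem_zpowers g₀
  -- the cores: the subgroups of prime order of `N`
  let core : ℕ → Subgroup G := fun ℓ => Subgroup.zpowers (g₀ ^ (n / ℓ))
  have hcore_ord : ∀ ℓ, ℓ.Prime → ℓ ∣ n → orderOf (g₀ ^ (n / ℓ)) = ℓ := by
    intro ℓ hℓ hℓn
    have hdiv : n / ℓ ∣ orderOf g₀ := by rw [hn]; exact Nat.div_dvd_of_dvd hℓn
    have hne : n / ℓ ≠ 0 := (Nat.div_pos (Nat.le_of_dvd (Nat.pos_of_ne_zero hn0) hℓn) hℓ.pos).ne'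
    rw [orderOf_pow_of_dvd hne hdiv, hn, Nat.div_div_self hℓn hn0]
  have hcoreN : ∀ ℓ, g₀ ^ (n / ℓ) ∈ N := fun ℓ => Subgroup.pow_mem _ hg₀N _
  -- elements of order prime to `p` lie in `N`
  have htame : ∀ h : G, (orderOf h).Coprime p → h ∈ N := by
    intro h hh
    obtain ⟨e, he⟩ := hQ (QuotientGroup.mk' N h)
    have h1 : orderOf (QuotientGroup.mk' N h) ∣ p ^ e := orderOf_dvd_of_pow_eq_one he
    have h2 : orderOf (QuotientGroup.mk' N h) ∣ orderOf h := orderOf_map_dvd _ h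
    have h3 : orderOf (QuotientGroup.mk' N h) ∣ Nat.gcd (orderOf h) (p ^ e) := Nat.dvd_gcd h2 h1
    rw [(Nat.Coprime.pow_right e hh).gcd_eq_one, Nat.dvd_one, orderOf_eq_one_iff,
      QuotientGroup.mk'_apply, QuotientGroup.eq_one_iff] at h3
    exact h3
  refine phaseZero_of_tameCores p hp k X' X₁ f q G ρ hfaith hreg hρ (n.primeFactorsList.map core)
    (fun M hM => ?_) (fun H hH h hhH hh1 hh => ?_)
  · -- each core is normal, non-trivial, of order prime to `p`
    obtain ⟨ℓ, hℓ, rfl⟩ := List.mem_map.mp hM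
    obtain ⟨hℓp, hℓn⟩ := (Nat.mem_primeFactorsList hn0).mp hℓ
    have hord := hcore_ord ℓ hℓp hℓn
    refine ⟨normal_zpowers_of_mem_cyclic (N := N) (hcoreN ℓ), ?_, ?_⟩
    · rw [Ne, Subgroup.zpowers_eq_bot, ← orderOf_eq_one_iff, hord]
      exact hℓp.one_lt.ne'
    · change (Nat.card (Subgroup.zpowers (g₀ ^ (n / ℓ)))).Coprime p
      rw [Nat.card_zpowers, hord]
      exact Nat.Coprime.coprime_dvd_left hℓn hN
  · -- a tame `h ≠ 1` contains the core of order `ℓ ∣ ord h`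
    have hhN : h ∈ N := htame h hh
    have hordh : orderOf h ≠ 1 := fun e => hh1 (orderOf_eq_one_iff.mp e)
    obtain ⟨ℓ, hℓp, hℓh⟩ := Nat.exists_prime_and_dvd hordh
    have hℓn : ℓ ∣ n := hℓh.trans (N.orderOf_dvd_natCard hhN)
    refine ⟨core ℓ, List.mem_map.mpr ⟨ℓ, (Nat.mem_primeFactorsList hn0).mpr ⟨hℓp, hℓn⟩, rfl⟩, ?_⟩
    refine (Subgroup.zpowers_le).mpr (mem_zpowers_of_pow_orderOf_eq_one (N := N) (hcoreN ℓ) hhN ?_)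
    exact orderOf_dvd_iff_pow_eq_one.mp (by rw [hcore_ord ℓ hℓp hℓn]; exact hℓh)

end Summit.ResolutionOfSingularities.ResolutionOfSingularities.Theorems.WildQuotientResolution.StandardForm

end
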